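import Summits.Ventures.HodgeRepro2.T6B4Main

/-!
# T6B4Model — joint satisfiability of the B4 hypotheses (non-vacuity certificate; Tier 6, sub-goal B4)

Cell pub-hodge-repro2, owner t6-p7 (route/T6-B4-t6-p7.md §4 / README §10.5(ii)(d)). The B3 ↔ B4
interface Props `EqCompat` (Eq) and `HodgeDictionary` (D) of T6B4Interface.lean are shown to hold
SIMULTANEOUSLY on a model instance: the «model type» `Φ̃(τ′) := {θ : ∃ g ∈ Aut(ℂ) extending θ with
g⁻¹ ∘ τ′ ∈ Φ_μ}` — the right-hand side of the displayed formula of CLAIM (B4-I) read as a definition —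
satisfies (Eq) for every `M̃_μ` and every `Φ_μ`, and (D) as soon as `M̃_μ ⊇ M_μ` (the reflex field,
`complexTraceField Φ_μ`; Liu 2021 p. 41 l. 49). Hence the hypotheses of `B4_main` are jointly
satisfiable for every Galois CM field, every base embedding, every finite `Φ_μ` and every number
field `M̃_μ ⊇ M_μ` containing `F₁`, and `B4_main` then returns `Φ̃(τ₁) = inducedSet (Φ_μ⁻¹)`.
Proof lane: 0 sorry; axioms ⊆ {propext, Classical.choice, Quot.sound}.
§8(d): uses an L-value-free non-vanishing device: NO.
-/

namespace Summit.Ventures.HodgeRepro2.T6.B4Model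

open Summit.Ventures.HodgeRepro2 Summit.Ventures.HodgeRepro2.T6.B4Interface
  Summit.Ventures.HodgeRepro2.T6.B4Main

variable {K : Type*} [Field K]

/-- The MODEL CM-type function: `Φt τ' := {θ : M →+* ℂ | ∃ g ∈ Aut(ℂ) extending θ with g⁻¹ ∘ τ' ∈ Φ_μ}`
— the right-hand side of the displayed formula of CLAIM (B4-I), read as a definition. It is the
instance on which the interface Props (Eq) and (D) are shown to hold jointly (README §10.5(ii)(d)). -/
def modelType (M : IntermediateField ℚ ℂ) (Φμ : Set (K →+* ℂ)) (τ' : K →+* ℂ) :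
    Set (M →+* ℂ) :=
  {θ | ∃ g : ℂ ≃+* ℂ, (∀ x : M, g x = θ x) ∧ (g.symm : ℂ →+* ℂ).comp τ' ∈ Φμ}

/-- Membership in the model type, unfolded. -/
theorem mem_modelType_iff (M : IntermediateField ℚ ℂ) (Φμ : Set (K →+* ℂ)) (τ' : K →+* ℂ)
    (θ : M →+* ℂ) :
    θ ∈ modelType M Φμ τ' ↔
      ∃ g : ℂ ≃+* ℂ, (∀ x : M, g x = θ x) ∧ (g.symm : ℂ →+* ℂ).comp τ' ∈ Φμ :=
  Iff.rfl

/-- The model type satisfies (Eq) for every `M` and every `Φ_μ`: `Φ̃(h ∘ τ') = h ∘ Φ̃(τ')`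
(transport the extension `g` by `h`). -/
theorem eqCompat_modelType (M : IntermediateField ℚ ℂ) (Φμ : Set (K →+* ℂ)) :
    EqCompat M (modelType M Φμ) := by
  intro h τ'
  ext θ
  constructor
  · rintro ⟨g, hg, hmem⟩
    refine ⟨(h.symm : ℂ →+* ℂ).comp θ, ⟨g.trans h.symm, ?_, ?_⟩, ?_⟩
    · intro x
      simp [hg x]
    · convert hmem using 1
      ext x
      simp
    · ext x
      simp
  · rintro ⟨θ', ⟨g', hg', hmem'⟩, rfl⟩
    refine ⟨g'.trans h, ?_, ?_⟩
    · intro x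
      simp [hg' x]
    · convert hmem' using 1
      ext x
      simp

/-- The model type satisfies (D) as soon as `M̃_μ` contains the reflex field
`M_μ = complexTraceField Φ_μ` (Liu 2021 p. 41 l. 49): `algebraMap M ℂ ∈ Φ̃(τ') ⟺ τ' ∈ Φ_μ`
(an automorphism fixing `M̃_μ` pointwise fixes `M_μ`, hence stabilises `Φ_μ`: Lemma B4.1). -/
theorem hodgeDictionary_modelType (M : IntermediateField ℚ ℂ) (Φμ : Finset (K →+* ℂ))
    (hM : complexTraceField Φμ ≤ M) :
    HodgeDictionary M (↑Φμ : Set (K →+* ℂ)) (modelType M ↑Φμ) := by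
  intro τ'
  constructor
  · rintro ⟨g, hg, hmem⟩
    have h1 := inverse_mem_iff_of_agree hM τ' g (RingEquiv.refl ℂ) (fun x => by simpa using hg x)
    have h2 : ((RingEquiv.refl ℂ).symm : ℂ →+* ℂ).comp τ' = τ' := by
      ext x; simp
    rw [Finset.mem_coe] at hmem ⊢
    rw [h1, h2] at hmem
    exact hmem
  · intro hτ
    refine ⟨RingEquiv.refl ℂ, fun x => rfl, ?_⟩
    simpa using hτ

/-- **Joint satisfiability of the B4 hypotheses** (non-vacuity, README §10.5(ii)(d)): for every CM
field `K` Galois over ℚ, every base embedding `τ₁`, every finite set `Φ_μ` of embeddings and every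
number field `M̃_μ ⊇ M_μ`, the model type satisfies (Eq) and (D) simultaneously, and `B4_main`
applies to it: `Φ̃(τ₁) = inducedSet (Φ_μ⁻¹)` whenever `F₁ ⊆ M̃_μ`. -/
theorem modelType_inverseTypeForced [NumberField K] [IsGalois ℚ K] (τ₁ : K →+* ℂ)
    (Φμ : Finset (K →+* ℂ)) (M : IntermediateField ℚ ℂ) [FiniteDimensional ℚ M] [Algebra K M]
    (hτ : (algebraMap M ℂ).comp (algebraMap K M) = τ₁) (hM : complexTraceField Φμ ≤ M) :
    InverseTypeForced τ₁ (↑Φμ : Set (K →+* ℂ)) M (modelType M ↑Φμ) :=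
  B4_main τ₁ _ M hτ _ (eqCompat_modelType M _) (hodgeDictionary_modelType M Φμ hM)

end Summit.Ventures.HodgeRepro2.T6.B4Model
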